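import Literature.AlgebraicGeometry.Resolution.ZariskiFiniteness
import Literature.AlgebraicGeometry.Resolution.ArithmeticalThreefolds
import Literature.AlgebraicGeometry.Resolution.CompositeValuations
import Mathlib.RingTheory.Valuation.LocalSubring
import Mathlib.Algebra.Polynomial.Lifts
import HarnessLib

/-!
# Closed points of the Zariski–Riemann space and Cossart–Piltant's (LU) valuations

Topic: `Literature/AlgebraicGeometry/Resolution`. PROVED: the closed points of the
Zariski–Riemann space `Zar(K/A)` (`ZariskiRiemannSpace.lean`, `ZariskiFiniteness.lean`: `{v}`
is closed iff no valuation ring `𝒪_w ⊊ 𝒪_v` contains the image of `A`) are exactly the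
valuation rings `𝒪_v ⊇ A` whose residue field `κ(v)` is INTEGRAL (algebraic) over `A`, and —
for a local ring `(A, 𝔪, k)` — exactly the valuations of Cossart–Piltant's local uniformization
statement (LU): those dominating `A` (`𝔪_v ∩ A = 𝔪`) with `κ(v) | k` algebraic. This is the
sentence

  "The assumption on `v` in (LU) means that `v` is a closed point of `Zar(𝒳)`."

of Cossart–Piltant 2019, proof of journal Prop. 4.6 (arXiv v1: Prop. 4.4), Step 3, made formal,
and it plugs the named-fact antecedent `CPLocalUniformization A` (`ArithmeticalThreefolds.lean`,
CP's (LU) verbatim) into Zariski's finiteness theorem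
(`ZariskiRiemannSpace.exists_finite_resolvingSystem`): **(LU) for `A` + openness of regular
loci ⇒ a finite resolving system for `Zar(K/A)`**
(`exists_finite_resolvingSystem_of_cpLocalUniformization`).

Mechanism (Zariski–Samuel II, Ch. VI §17, proof of Thm. 38/39 and §3: composite valuations):
the valuation rings `𝒪_w ⊆ 𝒪_v` of `K` correspond to the valuation rings `W̄` of `κ(v)`
(`W̄ = 𝒪_w / 𝔪_v`, `𝒪_w = {x ∈ 𝒪_v : x̄ ∈ W̄}`: the tree's `residueValuationSubring` and
`residueOverringLift` of `CompositeValuations.lean`), and `A ⊆ 𝒪_w` iff the image of `A` in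
`κ(v)` lies in `W̄`; so `v` is closed iff every valuation ring of `κ(v)` containing the image of
`A` is `κ(v)` itself, iff `κ(v)` is integral over `A` (the integral closure is the intersection
of the valuation rings, Mathlib `iInf_valuationSubring_superset`).

## Content (namespace `Literature.AlgGeom`)

* `residueOverringLift_eq_self_iff` — the pull-back `{x ∈ 𝒪 : x̄ ∈ W̄}`
  (`residueOverringLift`, `CompositeValuations.lean`) is all of `𝒪` iff `W̄ = κ(𝒪)`.
* `ZariskiRiemannSpace.algebraMapHom`, `.residueHom` (`A → 𝒪_v → κ(v)`);
  `isClosed_singleton_iff_forall_valuationSubring`,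
  **`isClosed_singleton_iff_isIntegral`** (`{v}` closed ↔ `κ(v)` integral over `A`).
* `isIntegralElem_of_isIntegral_subring` (lifting monic relations along a surjection).
* Local base: **`isClosed_singleton_iff_cp`** (`{v}` closed ↔ CP's two (LU) hypotheses:
  `v(a) < 1` on `𝔪` and every element of `𝒪_v` is a root mod `𝔪_v` of a polynomial over `A`
  with a unit coefficient); `cpLocalUniformization_iff_isClosed`;
  `exists_finite_resolvingSystem_of_cpLocalUniformization`.

## References

* O. Zariski, P. Samuel, *Commutative Algebra* II, Ch. VI §17, Thms. 38–40; §3 (composite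
  valuations). [ZariskiSamuel1960]
* V. Cossart, O. Piltant, J. Algebra 529 (2019), §4.1 (LU) and proof of Prop. 4.6
  (arXiv:1412.0868v1: Prop. 4.4), Step 3. [CossartPiltant2019]
-/

noncomputable section

open IsLocalRing Polynomial

namespace Literature.AlgebraicGeometry.Resolution

universe u v

/-! ## Lifting integral dependence relations along a surjection -/

/-- If `φ : A → L` maps into a subring `S ⊆ L` and onto it, an element of `L` integral over `S`
is integral with respect to `φ` (lift the coefficients of a monic relation). [folklore] -/
theorem isIntegralElem_of_isIntegral_subring {A L : Type*} [CommRing A] [CommRing L]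
    [Nontrivial L] (φ : A →+* L) (S : Subring L) (hφ : ∀ a, φ a ∈ S)
    (hS : ∀ c ∈ S, ∃ a, φ a = c) {x : L} (hx : IsIntegral S x) : φ.IsIntegralElem x := by
  obtain ⟨q, hqm, hqx⟩ := hx
  let f : A →+* S := φ.codRestrict S hφ
  have hf : Function.Surjective f := fun c => by
    obtain ⟨a, ha⟩ := hS c c.2
    exact ⟨a, Subtype.ext ha⟩
  haveI : Nontrivial S := S.subtype.domain_nontrivial
  obtain ⟨p, hpq, -, hpm⟩ := Polynomial.lifts_and_degree_eq_and_monic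
    ((Polynomial.mem_lifts q).mpr (Polynomial.map_surjective f hf q)) hqm
  refine ⟨p, hpm, ?_⟩
  have : Polynomial.eval₂ φ x p = Polynomial.eval₂ (algebraMap S L) x q := by
    rw [← hpq, Polynomial.eval₂_map]
    rfl
  rw [this, hqx]

/-! ## Valuation rings below `𝒪` and valuation rings of the residue field `κ(𝒪)` -/

section Residue

variable {K : Type v} [Field K]

/-- The pull-back `{x ∈ 𝒪 : x̄ ∈ W̄}` of a valuation ring `W̄` of `κ(𝒪)` (the composite valuation;
`residueOverringLift` of `CompositeValuations.lean`) is all of `𝒪` iff `W̄ = κ(𝒪)`.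
[cite: ZariskiSamuel1960, Ch. VI §3] -/
theorem residueOverringLift_eq_self_iff {O : ValuationSubring K}
    {W : ValuationSubring (ResidueField O)} : residueOverringLift O W = O ↔ W = ⊤ := by
  constructor
  · intro h
    refine eq_top_iff.mpr fun y _ => ?_
    obtain ⟨y, rfl⟩ := residue_surjective y
    have hy : (y : K) ∈ residueOverringLift O W := by rw [h]; exact y.2
    obtain ⟨hy', hW⟩ := (mem_residueOverringLift_iff O W _).mp hy
    exact hW
  · intro h
    refine le_antisymm (residueOverringLift_le O W) fun x hx =>
      (mem_residueOverringLift_iff O W x).mpr ⟨hx, ?_⟩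
    rw [h]
    exact ValuationSubring.mem_top _

end Residue

/-! ## Closed points of `Zar(K/A)` -/

namespace ZariskiRiemannSpace

variable {A : Type u} {K : Type v} [CommRing A] [Field K] [Algebra A K]

/-- The structure map `A → 𝒪_v` of a point of `Zar(K/A)`. [folklore] -/
def algebraMapHom (v : ZariskiRiemannSpace A K) : A →+* v.asValuationSubring :=
  (algebraMap A K).codRestrict v.asValuationSubring v.algebraMap_mem

/-- `algebraMapHom` followed by the inclusion is `algebraMap A K`. [folklore] -/
@[simp]
theorem coe_algebraMapHom (v : ZariskiRiemannSpace A K) (a : A) :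
    (v.algebraMapHom a : K) = algebraMap A K a :=
  rfl

/-- The residue map `A → 𝒪_v → κ(v)` of a point of `Zar(K/A)`. [folklore] -/
def residueHom (v : ZariskiRiemannSpace A K) : A →+* ResidueField v.asValuationSubring :=
  (residue v.asValuationSubring).comp v.algebraMapHom

/-- `residueHom v a = residue (algebraMap a)`. [folklore] -/
theorem residueHom_apply (v : ZariskiRiemannSpace A K) (a : A) :
    v.residueHom a = residue v.asValuationSubring (v.algebraMapHom a) :=
  rfl

/-- **Closed points via the residue field**: `{v}` is closed in `Zar(K/A)` iff every valuation
ring of the residue field `κ(v)` containing the image of `A` is `κ(v)` itself (the valuation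
rings `𝒪_w ⊆ 𝒪_v` over `A` are the pull-backs `residueOverringLift` of those, and the image of
`𝒪_w` in `κ(v)` is `residueValuationSubring`, `CompositeValuations.lean`).
[cite: ZariskiSamuel1960, Ch. VI §17, Thm. 38] -/
theorem isClosed_singleton_iff_forall_valuationSubring {v : ZariskiRiemannSpace A K} :
    IsClosed ({v} : Set (ZariskiRiemannSpace A K)) ↔
      ∀ W : ValuationSubring (ResidueField v.asValuationSubring),
        (∀ a : A, v.residueHom a ∈ W) → W = ⊤ := by
  rw [isClosed_singleton_iff_forall_le]
  constructor
  · intro h W hW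
    let w : ZariskiRiemannSpace A K :=
      ⟨residueOverringLift v.asValuationSubring W, fun a =>
        (mem_residueOverringLift_iff _ W _).mpr ⟨v.algebraMap_mem a, hW a⟩⟩
    have hw : w = v := h w (residueOverringLift_le _ _)
    exact residueOverringLift_eq_self_iff.mp (congrArg asValuationSubring hw)
  · intro h w hw
    have htop : residueValuationSubring w.asValuationSubring v.asValuationSubring hw = ⊤ :=
      h _ fun a => (residue_mem_residueValuationSubring_iff _ _ hw (v.algebraMapHom a)).mpr
        (w.algebraMap_mem a)
    refine asValuationSubring_injective (le_antisymm hw fun x hx => ?_)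
    have hx' : residue v.asValuationSubring ⟨x, hx⟩ ∈
        residueValuationSubring w.asValuationSubring v.asValuationSubring hw := by
      rw [htop]; exact ValuationSubring.mem_top _
    exact (residue_mem_residueValuationSubring_iff _ _ hw ⟨x, hx⟩).mp hx'

/-- **Closed points of `Zar(K/A)` = residually integral valuations**: `{v}` is closed iff the
residue field `κ(v)` is integral over `A` (via `A → 𝒪_v → κ(v)`). (⇐): valuation rings are
integrally closed; (⇒): the integral closure of the image of `A` in `κ(v)` is the intersection
of the valuation rings containing it (Mathlib `iInf_valuationSubring_superset`), all equal to
`κ(v)` by the previous theorem. [cite: ZariskiSamuel1960, Ch. VI §17, Thm. 38] -/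
theorem isClosed_singleton_iff_isIntegral {v : ZariskiRiemannSpace A K} :
    IsClosed ({v} : Set (ZariskiRiemannSpace A K)) ↔ v.residueHom.IsIntegral := by
  rw [isClosed_singleton_iff_forall_valuationSubring]
  constructor
  · intro hall x
    have htop : (⨅ V : {V : ValuationSubring (ResidueField v.asValuationSubring) //
        Set.range v.residueHom ⊆ V.toSubring}, V.1.toSubring) = ⊤ := by
      refine iInf_eq_top.mpr ?_
      rintro ⟨V, hV⟩
      have : V = ⊤ := hall V fun a => hV ⟨a, rfl⟩
      subst this
      rfl
    rw [iInf_valuationSubring_superset] at htop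
    have hx : x ∈ (integralClosure (Subring.closure (Set.range v.residueHom))
        (ResidueField v.asValuationSubring)).toSubring := by
      rw [htop]; trivial
    have hx' : IsIntegral (Subring.closure (Set.range v.residueHom)) x := hx
    refine isIntegralElem_of_isIntegral_subring v.residueHom
      (Subring.closure (Set.range v.residueHom)) (fun a => Subring.subset_closure ⟨a, rfl⟩)
      (fun c hc => ?_) hx'
    have hle : Subring.closure (Set.range v.residueHom) ≤ v.residueHom.range :=
      Subring.closure_le.mpr fun _ ⟨a, ha⟩ => ⟨a, ha⟩
    exact RingHom.mem_range.mp (hle hc)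
  · intro hint W hW
    refine eq_top_iff.mpr fun y _ => ?_
    obtain ⟨p, hpm, hp⟩ := hint y
    let ψ : A →+* W := v.residueHom.codRestrict W hW
    have hy : IsIntegral W y := by
      refine ⟨p.map ψ, hpm.map ψ, ?_⟩
      rw [Polynomial.eval₂_map]
      exact hp
    obtain ⟨z, hz⟩ := (IsIntegralClosure.isIntegral_iff (A := W)).mp hy
    rw [← hz]
    exact z.2

/-! ## Local base ring: Cossart–Piltant's (LU) valuations are the closed points -/

section Local

variable [IsLocalRing A]

/-- If `κ(v)` is integral over the local ring `(A, 𝔪)`, then `𝔪` maps into `𝔪_v`: the image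
of `A` in `κ(v)` is a field, so `𝔪 = ker(A → κ(v))`. [folklore] -/
theorem residueHom_eq_zero_of_isIntegral {v : ZariskiRiemannSpace A K}
    (hint : v.residueHom.IsIntegral) {a : A} (ha : a ∈ maximalIdeal A) : v.residueHom a = 0 := by
  set φ := v.residueHom with hφ
  -- `κ(v)` is integral over the subring `φ(A)`, which is therefore a field
  haveI : Algebra.IsIntegral φ.range (ResidueField v.asValuationSubring) := by
    refine ⟨fun y => ?_⟩
    obtain ⟨p, hpm, hp⟩ := hint y
    refine ⟨p.map φ.rangeRestrict, hpm.map _, ?_⟩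
    rw [Polynomial.eval₂_map]
    exact hp
  have hfield : IsField φ.range :=
    isField_of_isIntegral_of_isField (R := φ.range) (S := ResidueField v.asValuationSubring)
      Subtype.coe_injective (Field.toIsField _)
  by_contra hne
  -- `φ a ≠ 0` is then invertible in `φ(A)`: `φ a * φ b = 1`, so `φ (1 - a b) = 0`
  obtain ⟨⟨_, b, rfl⟩, hb⟩ := hfield.mul_inv_cancel (a := ⟨φ a, a, rfl⟩)
    (fun h => hne (congrArg Subtype.val h))
  have hb' : φ a * φ b = 1 := congrArg Subtype.val hb
  have hunit : IsUnit (1 - a * b) :=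
    isUnit_one_sub_self_of_mem_nonunits (a * b) (Ideal.mul_mem_right b _ ha)
  have h0 : φ (1 - a * b) = 0 := by rw [map_sub, map_one, map_mul, hb', sub_self]
  exact (hunit.map φ).ne_zero h0

/-- **Closed points of `Zar(K/A)` for `(A, 𝔪, k)` local = the valuations of Cossart–Piltant's
(LU)**: `{v}` is closed iff (i) `v(a) < 1` for `a ∈ 𝔪` (i.e. `𝔪_v ∩ A = 𝔪`, domination) and
(ii) every `x ∈ 𝒪_v` satisfies `v(p(x)) < 1` for some polynomial `p` over `A` with a coefficient
outside `𝔪` (i.e. `κ(v) | k` is algebraic) — the two hypotheses of `CPLocalUniformization`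
(Cossart–Piltant §4.1 (LU): "`m_v ∩ A = m`, `k_v | k` algebraic"; proof of Prop. 4.6, Step 3:
"The assumption on `v` in (LU) means that `v` is a closed point of `Zar(𝒳)`").
[cite: CossartPiltant2019, proof of Prop. 4.6 (arXiv v1: Prop. 4.4), Step 3] -/
theorem isClosed_singleton_iff_cp {v : ZariskiRiemannSpace A K} :
    IsClosed ({v} : Set (ZariskiRiemannSpace A K)) ↔
      (∀ a ∈ maximalIdeal A, v.asValuationSubring.valuation (algebraMap A K a) < 1) ∧
      (∀ x : v.asValuationSubring, ∃ p : Polynomial A, (∃ i, p.coeff i ∉ maximalIdeal A) ∧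
        v.asValuationSubring.valuation (p.eval₂ (algebraMap A K) x) < 1) := by
  rw [isClosed_singleton_iff_isIntegral]
  set O := v.asValuationSubring with hO
  set φ := v.residueHom with hφ
  -- translation between `v(p(x)) < 1` and `p̄(x̄) = 0`
  have key : ∀ (p : Polynomial A) (x : O),
      O.valuation (p.eval₂ (algebraMap A K) x) < 1 ↔ Polynomial.eval₂ φ (residue O x) p = 0 := by
    intro p x
    have h1 : ((p.eval₂ v.algebraMapHom x : O) : K) = p.eval₂ (algebraMap A K) (x : K) := by
      rw [show ((p.eval₂ v.algebraMapHom x : O) : K) = O.subtype (p.eval₂ v.algebraMapHom x) from rfl,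
        Polynomial.hom_eval₂]
      rfl
    have h2 : residue O (p.eval₂ v.algebraMapHom x) = p.eval₂ φ (residue O x) :=
      Polynomial.hom_eval₂ p v.algebraMapHom (residue O) x
    rw [← h1, ← h2, ← ValuationSubring.valuation_lt_one_iff, residue_eq_zero_iff]
  -- `φ a = 0` iff `v(a) < 1`
  have key₁ : ∀ a : A, O.valuation (algebraMap A K a) < 1 ↔ φ a = 0 := by
    intro a
    have h3 := key Polynomial.X (v.algebraMapHom a)
    rw [Polynomial.eval₂_X, Polynomial.eval₂_X] at h3
    exact h3
  constructor
  · intro hint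
    refine ⟨fun a ha => (key₁ a).mpr (residueHom_eq_zero_of_isIntegral hint ha), fun x => ?_⟩
    obtain ⟨p, hpm, hp⟩ := hint (residue O x)
    refine ⟨p, ⟨p.natDegree, ?_⟩, (key p x).mpr hp⟩
    rw [hpm.coeff_natDegree]
    exact (Ideal.ne_top_iff_one _).mp (maximalIdeal.isMaximal A).ne_top
  · rintro ⟨hdom, halg⟩ y
    obtain ⟨x, rfl⟩ := residue_surjective y
    obtain ⟨p, ⟨i, hi⟩, hpx⟩ := halg x
    have hp0 : Polynomial.eval₂ φ (residue O x) p = 0 := (key p x).mp hpx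
    -- `ker φ = 𝔪`: `𝔪 ⊆ ker φ` by domination, and `ker φ` is proper
    have hker : ∀ a : A, φ a = 0 ↔ a ∈ maximalIdeal A := by
      intro a
      constructor
      · intro ha0
        by_contra hna
        have hua : IsUnit a := by
          by_contra h
          exact hna ((IsLocalRing.mem_maximalIdeal a).mpr (mem_nonunits_iff.mpr h))
        exact (hua.map φ).ne_zero ha0
      · intro ha
        exact (key₁ a).mp (hdom a ha)
    -- the top nonvanishing coefficient of `p̄ = p.map φ` is the image of a unit `u`
    set q := p.map φ with hq
    have hq0 : q ≠ 0 := by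
      intro hq0
      have : q.coeff i = 0 := by rw [hq0, Polynomial.coeff_zero]
      rw [hq, Polynomial.coeff_map] at this
      exact hi ((hker _).mp this)
    have hlead : q.leadingCoeff = φ (p.coeff q.natDegree) := by
      rw [Polynomial.leadingCoeff, hq, Polynomial.coeff_map]
    have hnotmem : p.coeff q.natDegree ∉ maximalIdeal A := fun hmem =>
      (Polynomial.leadingCoeff_ne_zero.mpr hq0) (hlead.trans ((hker _).mpr hmem))
    have hu : IsUnit (p.coeff q.natDegree) := by
      by_contra h
      exact hnotmem ((IsLocalRing.mem_maximalIdeal _).mpr (mem_nonunits_iff.mpr h))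
    -- normalise: `r = (u⁻¹ p)‾` is monic with coefficients in `φ(A)`, hence lifts to a monic
    -- polynomial over `A` vanishing at `x̄`
    set b : A := ↑hu.unit⁻¹ with hb
    have hbu : b * p.coeff q.natDegree = 1 := hu.val_inv_mul
    set r := (Polynomial.C b * p).map φ with hr
    have hr' : r = Polynomial.C (φ b) * q := by rw [hr, Polynomial.map_mul, Polynomial.map_C]
    have hrm : r.Monic := by
      rw [hr']
      apply Polynomial.monic_C_mul_of_mul_leadingCoeff_eq_one
      rw [hlead, ← map_mul, hbu, map_one]
    obtain ⟨s, hsr, -, hsm⟩ := Polynomial.lifts_and_degree_eq_and_monic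
      ((Polynomial.mem_lifts r).mpr ⟨_, rfl⟩) hrm
    refine ⟨s, hsm, ?_⟩
    rw [Polynomial.eval₂_eq_eval_map, hsr, hr', Polynomial.eval_C_mul, Polynomial.eval_map, hp0,
      mul_zero]

/-- Hence **Cossart–Piltant's (LU) for a local domain `A` is local uniformization at the closed
points of the Zariski–Riemann spaces `Zar(K/A)`**, `K = Frac A`, in the form consumed by
Zariski's finiteness theorem (`HasRegularCentre`: a finitely generated `A`-subalgebra
`T = A[s] ⊆ 𝒪_v` regular at the centre). [cite: CossartPiltant2019, §4.1 (LU)] -/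
theorem cpLocalUniformization_iff_isClosed {A : Type u} [CommRing A] [IsDomain A] [IsLocalRing A] :
    CPLocalUniformization A ↔
      ∀ (K : Type u) [Field K] [Algebra A K] [IsFractionRing A K] (v : ZariskiRiemannSpace A K),
        IsClosed ({v} : Set (ZariskiRiemannSpace A K)) →
          ∃ T : Subalgebra A K, T.FG ∧ HasRegularCentre T v := by
  constructor
  · intro hLU K _ _ _ v hv
    obtain ⟨hdom, halg⟩ := isClosed_singleton_iff_cp.mp hv
    obtain ⟨s, h, hreg⟩ := hLU K v.asValuationSubring v.algebraMap_mem hdom halg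
    exact ⟨Algebra.adjoin A (s : Set K), Subalgebra.fg_adjoin_finset s, h, hreg⟩
  · intro H K _ _ _ O hO hdom halg
    let v : ZariskiRiemannSpace A K := ⟨O, hO⟩
    obtain ⟨T, ⟨s, hs⟩, h, hreg⟩ := H K v (isClosed_singleton_iff_cp.mpr ⟨hdom, halg⟩)
    subst hs
    exact ⟨s, h, hreg⟩

/-- **(LU) ⇒ a finite resolving system** (Cossart–Piltant 2019, proof of Prop. 4.6, Step 3, first
half: "`Zar(𝒳)` is quasi-compact by [ZS2] theorem 40 … The assumption on `v` in (LU) means that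
`v` is a closed point of `Zar(𝒳)`. Regularity is a nonempty open property for any reduced `𝒴`
which is of finite type over `𝒳` because `A` is excellent."): if the local domain `A` is a J-2
ring (e.g. quasi-excellent, `IsQuasiExcellentRing.isJ2Ring`) and satisfies Cossart–Piltant's
(LU) (`CPLocalUniformization A`), then there are finitely many finitely generated
`A`-subalgebras `T₁, …, Tₙ` of `K = Frac A` such that every valuation ring of `K` containing `A`
has a regular centre on some `Tᵢ`. PROVED (Zariski's finiteness theorem
`exists_finite_resolvingSystem` + `cpLocalUniformization_iff_isClosed`).
[cite: CossartPiltant2019, proof of Prop. 4.6 (arXiv v1: Prop. 4.4), Step 3] -/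
theorem exists_finite_resolvingSystem_of_cpLocalUniformization {A K : Type u} [CommRing A]
    [IsDomain A] [IsLocalRing A] [Field K] [Algebra A K] [IsFractionRing A K]
    (hJ : IsJ2Ring A) (hLU : CPLocalUniformization A) :
    ∃ 𝒯 : Finset (Subalgebra A K), (∀ T ∈ 𝒯, T.FG) ∧
      ∀ w : ZariskiRiemannSpace A K, ∃ T ∈ 𝒯, HasRegularCentre T w :=
  exists_finite_resolvingSystem_of_isJ2Ring hJ
    fun v hv => cpLocalUniformization_iff_isClosed.mp hLU K v hv

/-- The same for a quasi-excellent local domain (Cossart–Piltant's standing hypothesis;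
quasi-excellent ⇒ J-2). [cite: CossartPiltant2019, proof of Prop. 4.6 (arXiv v1: Prop. 4.4), Step 3] -/
theorem exists_finite_resolvingSystem_of_isQuasiExcellentRing {A K : Type u} [CommRing A]
    [IsDomain A] [IsLocalRing A] [Field K] [Algebra A K] [IsFractionRing A K]
    (hA : IsQuasiExcellentRing A) (hLU : CPLocalUniformization A) :
    ∃ 𝒯 : Finset (Subalgebra A K), (∀ T ∈ 𝒯, T.FG) ∧
      ∀ w : ZariskiRiemannSpace A K, ∃ T ∈ 𝒯, HasRegularCentre T w :=
  exists_finite_resolvingSystem_of_cpLocalUniformization hA.isJ2Ring hLU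

end Local

end ZariskiRiemannSpace

end Literature.AlgebraicGeometry.Resolution

end
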